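import Summits.Ventures.HodgeRepro.Night3GSetFormModel
import Summits.Ventures.HodgeRepro.Night3GSetCorrespondence

/-!
# The Weil model with the concrete form and the correspondence hypothesis in its GEOMETRIC form

Blind re-derivation cell `pub-hodge-repro`, seat `night-3` (gen 5, row 3; NIGHT3.md §12).  Imports this gen's
`Night3GSetFormModel` (the instance `gsetModelQ` with the concrete form) and `Night3GSetCorrespondence`
(`contract_kun_eq_fibInt`: the model's `hproj`-map is the push-forward `pr_{M*}((·) ∪ pr_N^*(y ∪ Λ_N))`).
Namespace `HodgeRepro.Night3.GSetModel`.

* `corrGeom a y M N : H (M + N) →ₗ H M` — the correspondence `ξ ↦ ∫_{B_N} (ξ ∧ pr_N^*(y ∧ Λ_N))` of the corner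
  products (`fibInt` after the identification `|M + N| = |M| + |N|`);
* `HprojGeom Alg a` — «for `y ∈ Alg N` the correspondence `corrGeom a y M N` carries `Alg (M + N)` into `Alg M`»:
  the correspondence with the algebraic kernel `pr_N^*(y ∪ Λ_N)` preserves algebraic classes — the geometric
  reading of gen 4's `hproj` (Fulton, Intersection Theory Ch. 16; Kleiman §1; Lefschetz (1,1) for the `L_i`);
* `hproj_of_geom`: `HprojGeom` implies the model's `hproj` (by `contract_kun_eq_fibInt`);
* **`gsetModelGeom Alg a ha hmul hgeom : WeilModelKP`** and **`weilSpace_le_alg_of_faces_geom`**: «S4 on the concrete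
  Weil spaces of the census faces + Lefschetz (1,1) on the pairs + `hmul` + the correspondence hypothesis in its
  geometric form ⟹ the concrete Weil space of every zero-sum multiset of CM types is algebraic».

`Alg` stays abstract (S4 IS `weilSpace M ≤ Alg M`); the cycle map and the `ℚ`-structure are not modelled; nothing
here closes S4; nothing here says anything about the status of the Hodge conjecture for CM abelian varieties, which
is NOT proved.
-/

set_option autoImplicit false
open Finset Module TensorProduct
open scoped Pointwise
namespace HodgeRepro.Night3.GSetModel

variable {G : Type*} [Group G] [Fintype G] [DecidableEq G] [LinearOrder G]

/-- **The correspondence of the corner products**: `ξ ↦ ∫_{B_N} (ξ ∧ pr_N^*(y ∧ Λ_N))` on `H (M + N) → H M`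
(`fibInt` after the identification `|M + N| = |M| + |N|`). -/
noncomputable def corrGeom (c : G) (Φ₀ : Finset G)
    (a : ∀ M : Multiset (Finset G), Fin (Multiset.card M) → G → ℂ) {N : Multiset (Finset G)} (y : H N)
    (M : Multiset (Finset G)) : H (M + N) →ₗ[ℂ] H M :=
  corrR c Φ₀ (a N) y (Multiset.card M) ∘ₗ (castH (Multiset.card_add M N)).toLinearMap

/-- `corrGeom` unfolded: the integral over the second factor of `ξ ∧ pr_N^*(y ∧ Λ_N)`. -/
theorem corrGeom_apply (c : G) (Φ₀ : Finset G)
    (a : ∀ M : Multiset (Finset G), Fin (Multiset.card M) → G → ℂ) {N : Multiset (Finset G)} (y : H N)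
    (M : Multiset (Finset G)) (ξ : H (M + N)) :
    corrGeom c Φ₀ a y M ξ = fibInt (Multiset.card M) (Multiset.card N) (topDeg Φ₀ (Multiset.card N))
      ⟨(castH (Multiset.card_add M N) ξ : ExteriorAlgebra ℂ (V G (Multiset.card M + Multiset.card N))) *
        ExteriorAlgebra.map (inrMap (Multiset.card M) (Multiset.card N))
          ((y : ExteriorAlgebra ℂ (V G (Multiset.card N))) * (Λc c Φ₀ (a N) : ExteriorAlgebra ℂ (V G (Multiset.card N)))),
        mul_map_mul_Λc_mem (a N) _ y⟩ := rfl

/-- **The correspondence hypothesis in its geometric form**: for `y ∈ Alg N` the correspondence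
`pr_{M*}((·) ∪ pr_N^*(y ∪ Λ_N))` carries `Alg (M + N)` into `Alg M` (correspondences with algebraic kernels preserve
algebraic classes; `Λ_N` is a product of divisor classes). -/
def HprojGeom (c : G) (Φ₀ : Finset G) (Alg : ∀ M : Multiset (Finset G), Submodule ℂ (H M))
    (a : ∀ M : Multiset (Finset G), Fin (Multiset.card M) → G → ℂ) : Prop :=
  ∀ (M N : Multiset (Finset G)) (y : H N), y ∈ Alg N → (Alg (M + N)).map (corrGeom c Φ₀ a y M) ≤ Alg M

/-- **The geometric form implies the model's `hproj`** (`contract_kun_eq_fibInt`). -/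
theorem hproj_of_geom {c : G} (hc : IsComplexConj c) {Φ₀ : Finset G} (hΦ : IsCMType c Φ₀)
    (Alg : ∀ M : Multiset (Finset G), Submodule ℂ (H M))
    (a : ∀ M : Multiset (Finset G), Fin (Multiset.card M) → G → ℂ) (hgeom : HprojGeom c Φ₀ Alg a) :
    ∀ (M N : Multiset (Finset G)) (y : H N), y ∈ Alg N →
      ((Alg (M + N)).map (κ M N)).map (LemmaP.contract ((Qm hc hΦ a N).flip y)) ≤ Alg M := by
  intro M N y hy
  rw [← Submodule.map_comp]
  refine le_trans (le_of_eq ?_) (hgeom M N y hy)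
  congr 1
  apply LinearMap.ext fun ξ => ?_
  rw [LinearMap.comp_apply, κ, LinearMap.comp_apply, LinearEquiv.coe_coe, Qm, contract_kun_eq_fibInt hc hΦ]
  rfl

/-- **The `G`-set Weil model with the concrete form and the correspondence hypothesis in its geometric form.** -/
noncomputable def gsetModelGeom {c : G} (hc : IsComplexConj c) {Φ₀ : Finset G} (hΦ : IsCMType c Φ₀)
    (Alg : ∀ M : Multiset (Finset G), Submodule ℂ (H M))
    (a : ∀ M : Multiset (Finset G), Fin (Multiset.card M) → G → ℂ)
    (ha : ∀ M i ρ, ρ ∈ Φ₀ → a M i ρ ≠ 0)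
    (hmul : ∀ M N, (Submodule.map₂ (TensorProduct.mk ℂ (H M) (H N)) (Alg M) (Alg N)).map (μ M N) ≤ Alg (M + N))
    (hgeom : HprojGeom c Φ₀ Alg a) : WeilModelKP ℂ ℂ G (Multiset (Finset G)) :=
  gsetModelQ hc hΦ Alg a ha hmul (hproj_of_geom hc hΦ Alg a hgeom)

/-- **«S4-faces ⟹ S4» on the concrete `G`-set model, with the concrete form and the correspondence hypothesis in its
geometric form**: if the cross products of algebraic classes are algebraic (`hmul`), the correspondences
`pr_{M*}((·) ∪ pr_N^*(y ∪ Λ_N))` with `y` algebraic preserve algebraic classes (`hgeom`), the concrete Weil spaces of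
the conjugate pairs are algebraic (Lefschetz (1,1)) and those of the census faces are algebraic (S4 on the faces —
the route's open input), then the concrete Weil space `weilSpace M` is algebraic for every zero-sum multiset `M` of
CM types.  Lemma L, the closure combinatorics, Lemma P's linear algebra, the Künneth / eigenline bookkeeping, the form
`Q = ∫ x ∧ y ∧ Λ` with its monomial Gram matrix and the correspondence in coordinates are all in the kernel. -/
theorem weilSpace_le_alg_of_faces_geom {c : G} (hc : IsComplexConj c) {Φ₀ : Finset G} (hΦ : IsCMType c Φ₀)
    (Alg : ∀ M : Multiset (Finset G), Submodule ℂ (H M))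
    (a : ∀ M : Multiset (Finset G), Fin (Multiset.card M) → G → ℂ)
    (ha : ∀ M i ρ, ρ ∈ Φ₀ → a M i ρ ≠ 0)
    (hmul : ∀ M N, (Submodule.map₂ (TensorProduct.mk ℂ (H M) (H N)) (Alg M) (Alg N)).map (μ M N) ≤ Alg (M + N))
    (hgeom : HprojGeom c Φ₀ Alg a)
    (hpair : ∀ Φ, IsCMType c Φ → weilSpace {Φ, c • Φ} ≤ Alg {Φ, c • Φ})
    (hface : ∀ Φ p p', IsCMType c Φ → p' ∉ place c p →
      weilSpace (GSet.faceCornersMul c Φ p p') ≤ Alg (GSet.faceCornersMul c Φ p p'))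
    (M : Multiset (Finset G)) (hM : GSet.IsZeroSumG c M) : weilSpace M ≤ Alg M :=
  weilSpace_le_alg_of_faces_q hc hΦ Alg a ha hmul (hproj_of_geom hc hΦ Alg a hgeom) hpair hface M hM

end HodgeRepro.Night3.GSetModel
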